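import Mathlib.Topology.Connected.Basic
import Mathlib.Analysis.Convex.Topology
import Mathlib.Analysis.Complex.Basic
import Mathlib.Analysis.Normed.Module.Convex
import Mathlib.Analysis.Normed.Module.RCLike.Real
import HarnessLib

/-!
# One-sidedness with respect to a cross-cut — helper for `DiscretisationFamilyExists` (stmt-CriticalPhenomena-9644)

Abstract consequences of Newman's cross-cut theorem (tree: `Newman1939_crosscut_holds`): if an open
set `D` is split by a closed set `χ` into two disjoint open sets `U₁, U₂` (`D ⊆ U₁ ∪ U₂ ∪ χ`)
whose frontiers meet only inside `χ` (for a cross-cut of a Jordan domain the frontiers are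
`χ ∪ L₁`, `χ ∪ L₂` with `L₁ ∩ L₂ =` the two end-points, which lie on `χ`), then:

* `not_meets_both_of_isPreconnected` (**one-sidedness**): a preconnected subset of `closure D`
  disjoint from `χ` cannot meet both `U₁` and `U₂`;
* `subset_of_isPreconnected`: if it lies in `D`, it lies in one of them;
* `mem_of_segment`: the two ends of a segment in `closure D` missing `χ`, both in `U₁ ∪ U₂`, lie on
  the same side;
* `inter_subset_frontier_of_ball`: a closed disc about a point of `U i`, inside `closure D` with
  open part in `D`, missing `χ`, meets the complement of `D` only inside `frontier (U i)`.

In the construction of admissible Dobrushin data the two colour classes of the discrete boundary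
are the sides `U₁, U₂` of a cross-cut through the two cut edges; these lemmas give: every edge of
`Ω_δ` between boundary sites other than the two cut edges is monochromatic, and the nearest
boundary points ("feet") of a far site lie on the boundary arc of its own side.
-/

noncomputable section

open Set Metric

namespace Summit.CriticalPhenomena.CardyFormulaZ2.Theorems.DiscretisationFamilyExists

variable {D χ U₁ U₂ : Set ℂ}

/-- **One-sidedness.** Let `U₁, U₂` be disjoint open sets and `χ` a closed set with
`D ⊆ U₁ ∪ U₂ ∪ χ` and `frontier U₁ ∩ frontier U₂ ⊆ χ`.  A preconnected subset of `closure D`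
disjoint from `χ` does not meet both `U₁` and `U₂`: it would be covered by the closed sets
`closure U₁`, `closure U₂`, hence contain a point of both closures, which lies in neither open set,
so in both frontiers, so in `χ`. [folklore] -/
theorem not_meets_both_of_isPreconnected (h₁ : IsOpen U₁) (h₂ : IsOpen U₂) (hdisj : Disjoint U₁ U₂)
    (hχ : IsClosed χ) (hD : D ⊆ U₁ ∪ U₂ ∪ χ) (hfr : frontier U₁ ∩ frontier U₂ ⊆ χ)
    {S : Set ℂ} (hS : IsPreconnected S) (hSD : S ⊆ closure D) (hSχ : Disjoint S χ) :
    ¬ ((S ∩ U₁).Nonempty ∧ (S ∩ U₂).Nonempty) := by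
  rintro ⟨hn₁, hn₂⟩
  have hcov : S ⊆ closure U₁ ∪ closure U₂ := by
    intro x hx
    have hx' : x ∈ closure (U₁ ∪ U₂ ∪ χ) := closure_mono hD (hSD hx)
    rw [closure_union, closure_union, hχ.closure_eq] at hx'
    rcases hx' with (h | h) | h
    · exact Or.inl h
    · exact Or.inr h
    · exact absurd h (Set.disjoint_left.1 hSχ hx)
  obtain ⟨p, hpS, hp₁, hp₂⟩ := (isPreconnected_closed_iff.1 hS) _ _ isClosed_closure isClosed_closure hcov
    (let ⟨x, hxS, hx⟩ := hn₁; ⟨x, hxS, subset_closure hx⟩) (let ⟨x, hxS, hx⟩ := hn₂; ⟨x, hxS, subset_closure hx⟩)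
  have hpU₁ : p ∉ U₁ := fun h => Set.disjoint_left.1 (hdisj.closure_right h₁) h hp₂
  have hpU₂ : p ∉ U₂ := fun h => Set.disjoint_left.1 (hdisj.symm.closure_right h₂) h hp₁
  have hpf : p ∈ frontier U₁ ∩ frontier U₂ := by
    rw [frontier_eq_closure_inter_closure, frontier_eq_closure_inter_closure]
    exact ⟨⟨hp₁, subset_closure hpU₁⟩, ⟨hp₂, subset_closure hpU₂⟩⟩
  exact Set.disjoint_left.1 hSχ hpS (hfr hpf)

/-- A preconnected subset of `D` missing `χ` lies in `U₁` or in `U₂`. [folklore] -/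
theorem subset_or_subset_of_isPreconnected (h₁ : IsOpen U₁) (h₂ : IsOpen U₂) (hdisj : Disjoint U₁ U₂)
    (hχ : IsClosed χ) (hD : D ⊆ U₁ ∪ U₂ ∪ χ) (hfr : frontier U₁ ∩ frontier U₂ ⊆ χ)
    {S : Set ℂ} (hS : IsPreconnected S) (hSD : S ⊆ D) (hSχ : Disjoint S χ) :
    S ⊆ U₁ ∨ S ⊆ U₂ := by
  have hsub : S ⊆ U₁ ∪ U₂ := fun x hx => by
    rcases hD (hSD hx) with h | h
    · exact h
    · exact absurd h (Set.disjoint_left.1 hSχ hx)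
  by_cases hne₂ : (S ∩ U₂).Nonempty
  · right
    intro x hx
    rcases hsub hx with h | h
    · exact absurd ⟨⟨x, hx, h⟩, hne₂⟩ (not_meets_both_of_isPreconnected h₁ h₂ hdisj hχ hD hfr hS
        (hSD.trans subset_closure) hSχ)
    · exact h
  · left
    intro x hx
    rcases hsub hx with h | h
    · exact h
    · exact absurd ⟨x, hx, h⟩ hne₂

/-- **Same side along a segment of `closure D` missing the cross-cut.** If `x ∈ U i` and the
segment `[x, y]` lies in `closure D` and misses `χ`, then `y`, if in `U₁ ∪ U₂`, is in `U i`.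
(Edges of `Ω_δ` are such segments: this makes every edge between boundary sites not crossed by
the cross-cut monochromatic.) [folklore] -/
theorem mem_of_segment (h₁ : IsOpen U₁) (h₂ : IsOpen U₂) (hdisj : Disjoint U₁ U₂)
    (hχ : IsClosed χ) (hD : D ⊆ U₁ ∪ U₂ ∪ χ) (hfr : frontier U₁ ∩ frontier U₂ ⊆ χ)
    {x y : ℂ} (hseg : segment ℝ x y ⊆ closure D) (hsegχ : Disjoint (segment ℝ x y) χ) :
    (x ∈ U₁ → y ∈ U₁ ∪ U₂ → y ∈ U₁) ∧ (x ∈ U₂ → y ∈ U₁ ∪ U₂ → y ∈ U₂) := by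
  have key := not_meets_both_of_isPreconnected h₁ h₂ hdisj hχ hD hfr
    (convex_segment x y).isPreconnected hseg hsegχ
  refine ⟨fun hx hy => ?_, fun hx hy => ?_⟩
  · rcases hy with hy | hy
    · exact hy
    · exact absurd ⟨⟨x, left_mem_segment ℝ x y, hx⟩, ⟨y, right_mem_segment ℝ x y, hy⟩⟩ key
  · rcases hy with hy | hy
    · exact absurd ⟨⟨y, right_mem_segment ℝ x y, hy⟩, ⟨x, left_mem_segment ℝ x y, hx⟩⟩ key
    · exact hy

/-- **An open disc about a point of a side, inside `D` and missing the cross-cut, lies in that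
side.** [folklore] -/
theorem ball_subset_of_mem (h₁ : IsOpen U₁) (h₂ : IsOpen U₂) (hdisj : Disjoint U₁ U₂)
    (hχ : IsClosed χ) (hD : D ⊆ U₁ ∪ U₂ ∪ χ) (hfr : frontier U₁ ∩ frontier U₂ ⊆ χ)
    {z : ℂ} {r : ℝ} (hball : ball z r ⊆ D) (hballχ : Disjoint (ball z r) χ) :
    (z ∈ U₁ → ball z r ⊆ U₁) ∧ (z ∈ U₂ → ball z r ⊆ U₂) := by
  have key := subset_or_subset_of_isPreconnected h₁ h₂ hdisj hχ hD hfr (convex_ball z r).isPreconnected hball hballχ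
  refine ⟨fun hz => ?_, fun hz => ?_⟩
  · rcases key with h | h
    · exact h
    · rcases le_or_gt r 0 with hr | hr
      · rw [ball_eq_empty.2 hr]; exact empty_subset _
      · exact absurd (h (mem_ball_self hr)) (Set.disjoint_left.1 hdisj hz)
  · rcases key with h | h
    · rcases le_or_gt r 0 with hr | hr
      · rw [ball_eq_empty.2 hr]; exact empty_subset _
      · exact absurd hz (Set.disjoint_left.1 hdisj (h (mem_ball_self hr)))
    · exact h

/-- **Feet on the own arc.** If the open disc `ball z r` (`r > 0`) lies in `U i` then every point
of the closed disc `closedBall z r` off `D` lies in `frontier (U i)` (it is in the closure of the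
open disc, hence of `U i`, and not in `U i ⊆ D`).  For a far boundary site with its empty disc this
puts its nearest boundary points on the boundary arc of its own side. [folklore] -/
theorem mem_frontier_of_mem_closedBall {U : Set ℂ} (hUD : U ⊆ D) {z p : ℂ} {r : ℝ} (hr : 0 < r)
    (hball : ball z r ⊆ U) (hp : p ∈ closedBall z r) (hpD : p ∉ D) : p ∈ frontier U := by
  rw [frontier_eq_closure_inter_closure]
  refine ⟨?_, subset_closure fun h => hpD (hUD h)⟩
  rw [← closure_ball z hr.ne'] at hp
  exact closure_mono hball hp

end Summit.CriticalPhenomena.CardyFormulaZ2.Theorems.DiscretisationFamilyExists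

end
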